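import Literature.Claims.NS.VasquezCampos2024
import Literature.Analysis.Fourier.LpMultiplierDilation
import Summits.NavierStokesRegularity.NavierStokesRegularity.Theorems.PlanarFluxAPriori.Negative.SlabApexBoundApexFoamField
import Mathlib.Analysis.Distribution.SchwartzSpace.Fourier
import HarnessLib

/-!
# C35 `VasquezCampos2024` — the §2/§6 composition is false at both grains

NS-CLAIMS SWEEP (D-0090), refuter lane C35 (text of record arXiv:2405.07929 v3). The skeleton
`Literature.Claims.NS.VasquezCampos2024` (p479616 + p480315) composes the paper's steps into Clay (A)
ONLY through the implicit Step 2: the sentence §2 l.713 (v3 PDF p.5) «it is enough to solve the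
Navier-Stokes Equation for an arbitrary or sufficiently large viscosity `ν > 0`» read against the only
printed pin of «large enough», Cor. 23 (`vfastdecrease`) proof l.2306 p.27
«iff `ν > (2C/π)‖max{1,|ξ|}^{(d+1)/2} û⁰‖_{1⊕2}`». Two kernel refutations:

* `not_CompositionRule` — the rule at the ABSTRACT grain (`CompositionRule`, HYGIENE 13): a per-datum
  threshold that scales with degree one under the rescaling does not compose with the scaling
  equivalence. Toy: `W = ℝ`, `scale α w = αw`, `P w ν :⇔ w < ν`; fails at `w = 1`, `ν = ½`.
* `not_GlueThreshold` — the INSTANCE (`GlueThreshold C`, every `C > 0`): for the compactly supported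
  divergence-free datum `u⁰ = curl(χΨ₀)` of the tree (`ApexFoam.vfield 0`) and
  `ν = (2C/π)·min(‖û⁰‖_{L¹}, ‖û⁰‖_{L²})`, NO `α > 0` puts `(αν, u⁰(·/α))` above the threshold:
  `û` of `u⁰(·/α)` is `α³ û⁰(α·)` (`Literature.Analysis.Fourier.fourierInv_comp_smul`), so the `L¹` part of
  `‖max{1,|ξ|}² û_α‖_{1⊕2}` is `≥ ‖û⁰‖_{L¹}` and the `L²` part is `≥ α^{3/2}‖û⁰‖_{L²}`
  (`eLpNorm_comp_smul`, weight `≥ 1`), which beats `αν` for `α ≤ 1` and `α ≥ 1` respectively.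

Mathlib (Schwartz maps and their Fourier transform, `eLpNorm`), the tree's dilation identities and the
tree's bump-supported solenoidal field; no Navier–Stokes dynamics enters.
-/

noncomputable section

-- Problem = summit for this single-conjunct summit: the duplicate namespace component is deliberate.
set_option linter.dupNamespace false

namespace Summit.NavierStokesRegularity.NavierStokesRegularity.Theorems.VasquezCampos2024

open MeasureTheory FourierTransform Set Filter
open scoped SchwartzMap ENNReal ContDiff Topology
open Literature.Analysis.FluidPDE Literature.Claims.NS.VasquezCampos2024
open Literature.Analysis.FunctionSpaces (EuclideanSpace.complexify EuclideanSpace.complexify_injective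
  EuclideanSpace.contDiff_complexify_comp_iff)
open Summit.NavierStokesRegularity.NavierStokesRegularity.Theorems.PlanarFluxAPriori.Negative

/-! ### Step 2 at the abstract grain -/

/-- **Step 2 of C35 is false at the abstract grain** (§2 l.713 p.5 × Cor. 23 proof l.2306 p.27):
the composition rule «`P` holds for every datum above a datum-dependent viscosity threshold» +
«`P w ν ↔ P (scale α w) (αν)`» ⇒ «`P` for all data and all `ν > 0`» fails for the degree-one toy
threshold `W = ℝ`, `scale α w = αw`, `P w ν :⇔ w < ν` (take `w = 1`, `ν = ½`).
[cite: VasquezCampos2024, §2 l.713 p.5; Cor. 23 proof l.2301–2306 p.27] -/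
theorem not_CompositionRule : ¬ Literature.Claims.NS.VasquezCampos2024.CompositionRule := by
  intro h
  have key := h ℝ (fun α w => α * w) (fun w ν => w < ν) (fun w => ⟨w, fun ν hν => hν⟩)
    (fun w ν α hα => (mul_lt_mul_iff_of_pos_left hα).symm) 1 (1 / 2) (by norm_num)
  norm_num at key

/-! ### Step 2 at the instance grain: Fourier bookkeeping -/

/-- The complexified datum `x ↦ (u⁰(x))_ℂ` as a Schwartz map (Fefferman's (4) is Schwartz decay; the
complexification is a real linear isometry, so the derivative norms agree). [folklore] -/
def datumSchwartz {u₀ : R3 → R3} (hs : ContDiff ℝ ∞ u₀) (hdec : HasRapidSpatialDecay u₀) :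
    𝓢(R3, C3) where
  toFun := EuclideanSpace.complexify ∘ u₀
  smooth' := EuclideanSpace.contDiff_complexify_comp_iff.2 hs
  decay' k n := by
    obtain ⟨C, hC⟩ := hdec n k
    refine ⟨C, fun x => ?_⟩
    rw [LinearIsometry.norm_iteratedFDeriv_comp_left _ hs.contDiffAt (mod_cast le_top)]
    calc ‖x‖ ^ k * ‖iteratedFDeriv ℝ n u₀ x‖ ≤ (1 + ‖x‖) ^ k * ‖iteratedFDeriv ℝ n u₀ x‖ := by
          gcongr; linarith [norm_nonneg x]
      _ ≤ C := hC x

/-- Values of `datumSchwartz`. [folklore] -/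
@[simp] theorem datumSchwartz_apply {u₀ : R3 → R3} (hs : ContDiff ℝ ∞ u₀) (hdec : HasRapidSpatialDecay u₀)
    (x : R3) : datumSchwartz hs hdec x = EuclideanSpace.complexify (u₀ x) := rfl

/-- The paper's `û⁰ = 𝓕⁻u⁰` (`hat`) is the Schwartz-space inverse Fourier transform of the complexified
datum. [cite: VasquezCampos2024, §6 l.2008 p.23] -/
theorem hat_eq {u₀ : R3 → R3} (hs : ContDiff ℝ ∞ u₀) (hdec : HasRapidSpatialDecay u₀) :
    hat u₀ = ⇑(𝓕⁻ (datumSchwartz hs hdec) : 𝓢(R3, C3)) := by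
  rw [SchwartzMap.fourierInv_coe]; rfl

/-- A datum that does not vanish identically has `û⁰` with non-zero `Lᵖ` norms (Fourier inversion on
the Schwartz space + continuity of `û⁰`). [folklore] -/
theorem eLpNorm_hat_ne_zero {u₀ : R3 → R3} (hs : ContDiff ℝ ∞ u₀) (hdec : HasRapidSpatialDecay u₀)
    {x₀ : R3} (hx₀ : u₀ x₀ ≠ 0) {p : ℝ≥0∞} (hp : p ≠ 0) : eLpNorm (hat u₀) p volume ≠ 0 := by
  set S := datumSchwartz hs hdec with hS
  set T : 𝓢(R3, C3) := 𝓕⁻ S with hT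
  intro h0
  rw [hat_eq hs hdec] at h0
  have h1 : ⇑T =ᵐ[volume] (0 : R3 → C3) :=
    (eLpNorm_eq_zero_iff T.continuous.aestronglyMeasurable hp).mp h0
  have h2 : ⇑T = 0 :=
    (Continuous.ae_eq_iff_eq volume T.continuous continuous_const).mp h1
  have h3 : T = 0 := by
    refine SchwartzMap.ext fun x => ?_
    simpa using congrFun h2 x
  have h4 : S = 0 := by
    rw [← FourierTransform.fourier_fourierInv_eq (E := 𝓢(R3, C3)) (F := 𝓢(R3, C3)) S]
    change 𝓕 T = 0
    rw [h3]
    exact map_zero (SchwartzMap.fourierTransformCLM ℂ)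
  have h5 : EuclideanSpace.complexify (u₀ x₀) = 0 := by
    have := congrArg (fun T : 𝓢(R3, C3) => T x₀) h4
    simpa [hS] using this
  exact hx₀ (EuclideanSpace.complexify_injective (by rw [h5, map_zero]))

/-- `û` of the rescaled datum: `hat (u⁰(·/α)) ξ = α³ • û⁰(αξ)` (`d = 3`, `α > 0`).
[cite: VasquezCampos2024, §2 l.660–700 pp.4–5] -/
theorem hat_rescale (u₀ : R3 → R3) {α : ℝ} (hα : 0 < α) :
    hat (fun x => u₀ (α⁻¹ • x)) = fun ξ => (α ^ 3) • hat u₀ (α • ξ) := by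
  unfold hat
  have h := Literature.Analysis.Fourier.fourierInv_comp_smul (EuclideanSpace.complexify ∘ u₀)
    (inv_ne_zero hα.ne')
  rw [finrank_euclideanSpace_fin] at h
  simp only [inv_pow, inv_inv, abs_of_pos (pow_pos hα 3)] at h
  exact h

/-- **Dilation lower bound**: `α³ · (α³)^{-1/p} · ‖û⁰‖_{Lᵖ} ≤ ‖max{1,|ξ|}² û_α‖_{Lᵖ}` for the rescaled
datum `u_α = u⁰(·/α)` (weight `≥ 1`, `‖g(α·)‖_p = α^{-3/p}‖g‖_p`).
[cite: VasquezCampos2024, Cor. 23 proof l.2301–2306 p.27 with §2 l.713 p.5] -/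
theorem eLpNorm_weightFn_rescale_ge {u₀ : R3 → R3} (hmeas : AEStronglyMeasurable (hat u₀) volume)
    {α : ℝ} (hα : 0 < α) (p : ℝ≥0∞) :
    ENNReal.ofReal (α ^ 3) * (ENNReal.ofReal (α ^ 3)⁻¹ ^ (1 / p).toReal * eLpNorm (hat u₀) p volume)
      ≤ eLpNorm (weightFn 2 (fun x => u₀ (α⁻¹ • x))) p volume := by
  have hdil := Literature.Analysis.Fourier.eLpNorm_comp_smul hmeas hα.ne' p
  rw [finrank_euclideanSpace_fin, abs_of_pos (inv_pos.mpr (pow_pos hα 3))] at hdil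
  have hsm : eLpNorm (fun ξ => α ^ 3 * ‖hat u₀ (α • ξ)‖) p volume
      = ENNReal.ofReal (α ^ 3) * eLpNorm (fun ξ => hat u₀ (α • ξ)) p volume := by
    have h := eLpNorm_const_smul (α ^ 3) (fun ξ => ‖hat u₀ (α • ξ)‖) p volume
    rw [eLpNorm_norm, Real.enorm_eq_ofReal (pow_pos hα 3).le] at h
    exact h
  rw [← hdil, ← hsm]
  refine eLpNorm_mono_real fun ξ => ?_
  rw [Real.norm_of_nonneg (by positivity)]
  show α ^ 3 * ‖hat u₀ (α • ξ)‖ ≤ max 1 ‖ξ‖ ^ (2 : ℝ) * ‖hat (fun x => u₀ (α⁻¹ • x)) ξ‖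
  simp only [hat_rescale u₀ hα, norm_smul, Real.norm_eq_abs, abs_of_pos (pow_pos hα 3)]
  exact le_mul_of_one_le_left (by positivity) (Real.one_le_rpow (le_max_left _ _) (by norm_num))

/-- **Finiteness**: for a datum the weighted transform `max{1,|ξ|}² |û⁰(ξ)|` lies in `L¹ ∩ L²`
(`û⁰` is Schwartz; `max{1,r}² ≤ 1 + r²`). [cite: VasquezCampos2024, §6 l.2274 p.27] -/
theorem eLpNorm_weightFn_lt_top {u₀ : R3 → R3} (hs : ContDiff ℝ ∞ u₀) (hdec : HasRapidSpatialDecay u₀) :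
    eLpNorm (weightFn 2 u₀) 1 volume < ⊤ ∧ eLpNorm (weightFn 2 u₀) 2 volume < ⊤ := by
  set T : 𝓢(R3, C3) := 𝓕⁻ (datumSchwartz hs hdec) with hT
  have hhat : hat u₀ = ⇑T := hat_eq hs hdec
  have hW : weightFn 2 u₀ = fun ξ => max 1 ‖ξ‖ ^ 2 * ‖T ξ‖ := by
    funext ξ; simp only [weightFn, hhat, Real.rpow_two]
  have hcont : Continuous (weightFn 2 u₀) := by
    rw [hW]
    exact ((continuous_const.max continuous_norm).pow 2).mul T.continuous.norm
  have hmeas : AEStronglyMeasurable (weightFn 2 u₀) volume := hcont.aestronglyMeasurable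
  have hmax : ∀ ξ : R3, max 1 ‖ξ‖ ^ 2 ≤ 1 + ‖ξ‖ ^ 2 := fun ξ => by
    rcases le_total 1 ‖ξ‖ with h | h
    · rw [max_eq_right h]; linarith
    · rw [max_eq_left h]; nlinarith [norm_nonneg ξ]
  have hI0 := T.integrable_pow_mul volume 0
  have hI2 := T.integrable_pow_mul volume 2
  have hI4 := T.integrable_pow_mul volume 4
  constructor
  · have hint : Integrable (weightFn 2 u₀) volume := by
      refine Integrable.mono' (hI0.add hI2) hmeas (Eventually.of_forall fun ξ => ?_)
      rw [hW, Real.norm_of_nonneg (by positivity)]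
      simp only [Pi.add_apply, pow_zero, one_mul]
      calc max 1 ‖ξ‖ ^ 2 * ‖T ξ‖ ≤ (1 + ‖ξ‖ ^ 2) * ‖T ξ‖ := by gcongr; exact hmax ξ
        _ = ‖T ξ‖ + ‖ξ‖ ^ 2 * ‖T ξ‖ := by ring
    exact (memLp_one_iff_integrable.mpr hint).eLpNorm_lt_top
  · set M : ℝ := SchwartzMap.seminorm ℝ 0 0 T with hM
    have hTM : ∀ ξ, ‖T ξ‖ ≤ M := fun ξ => SchwartzMap.norm_le_seminorm ℝ T ξ
    have hint : Integrable (fun ξ => weightFn 2 u₀ ξ ^ 2) volume := by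
      refine Integrable.mono' (((hI0.add (hI2.const_mul 2)).add hI4).const_mul M)
        (hcont.pow 2).aestronglyMeasurable (Eventually.of_forall fun ξ => ?_)
      rw [hW, Real.norm_of_nonneg (by positivity)]
      simp only [Pi.add_apply, pow_zero, one_mul]
      calc (max 1 ‖ξ‖ ^ 2 * ‖T ξ‖) ^ 2 = (max 1 ‖ξ‖ ^ 2) ^ 2 * (‖T ξ‖ * ‖T ξ‖) := by ring
        _ ≤ (1 + ‖ξ‖ ^ 2) ^ 2 * (‖T ξ‖ * M) := by gcongr; exact hmax ξ; exact hTM ξ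
        _ = M * (‖T ξ‖ + 2 * (‖ξ‖ ^ 2 * ‖T ξ‖) + ‖ξ‖ ^ 4 * ‖T ξ‖) := by ring
    exact ((memLp_two_iff_integrable_sq hmeas).mpr hint).eLpNorm_lt_top

/-! ### The witness datum and the refutation -/

/-- The witness datum: the tree's bump-supported solenoidal field `curl(χΨ₀)` with profile `g ≡ 0`
(`ApexFoam.vfield`); on the ball `B(0,2)` it equals `(x₂, 0, 0)`. [folklore] -/
def wdatum : R3 → R3 := ApexFoam.vfield (fun _ => (0 : ℝ))

/-- The witness is an admissible datum: smooth, divergence free, rapidly decaying. [folklore] -/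
theorem isDatum_wdatum : IsDatum wdatum :=
  ⟨ApexFoam.contDiff_vfield contDiff_const, fun x => ApexFoam.isDivFree_vfield contDiff_const x,
    ApexFoam.hasRapidSpatialDecay_vfield contDiff_const⟩

/-- The witness does not vanish at `e₂` (there it equals `e₀`). [folklore] -/
theorem wdatum_ne : wdatum (EuclideanSpace.single (2 : Fin 3) (1 : ℝ)) ≠ 0 := by
  have hx : EuclideanSpace.single (2 : Fin 3) (1 : ℝ) ∈ Metric.ball (0 : R3) 2 := by
    rw [Metric.mem_ball, dist_zero_right, PiLp.norm_single]
    norm_num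
  unfold wdatum
  rw [ApexFoam.vfield_eq contDiff_const hx]
  intro h
  have h0 := congrArg (fun v : R3 => v 0) h
  simp [ApexFoam.V₀, ApexFoam.e] at h0

/-- **Step 2 of C35 is false at the instance grain, for every constant `C > 0`**
(`GlueThreshold C`: «for every `ν > 0` and datum `u⁰` some `α > 0` has
`(2C/π)‖max{1,|ξ|}² 𝓕⁻[u⁰(·/α)]‖_{L¹⊕L²} < αν`»). Witness: `u⁰ = wdatum`,
`ν = (2C/π)·min(‖û⁰‖_{L¹}, ‖û⁰‖_{L²})`; for `α ≤ 1` the `L¹` part alone is `≥ ‖û⁰‖_{L¹} ≥ α·min`,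
for `α ≥ 1` the `L²` part alone is `≥ α^{3/2}‖û⁰‖_{L²} ≥ α·min`.
[cite: VasquezCampos2024, §2 l.713 p.5; Cor. 23 (`vfastdecrease`) proof l.2301–2306 p.27] -/
theorem not_GlueThreshold {C : ℝ} (hC : 0 < C) :
    ¬ Literature.Claims.NS.VasquezCampos2024.GlueThreshold C := by
  intro hG
  have hD := isDatum_wdatum
  obtain ⟨hs, -, hdec⟩ := hD
  set T : 𝓢(R3, C3) := 𝓕⁻ (datumSchwartz hs hdec) with hT
  have hhat : hat wdatum = ⇑T := hat_eq hs hdec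
  have hmeas : AEStronglyMeasurable (hat wdatum) volume := by
    rw [hhat]; exact T.continuous.aestronglyMeasurable
  have hfin : ∀ p : ℝ≥0∞, eLpNorm (hat wdatum) p volume ≠ ⊤ := fun p => by
    rw [hhat]; exact (T.eLpNorm_lt_top p volume).ne
  set A₁ : ℝ := (eLpNorm (hat wdatum) 1 volume).toReal with hA₁def
  set A₂ : ℝ := (eLpNorm (hat wdatum) 2 volume).toReal with hA₂def
  have hA₁ : 0 < A₁ :=
    ENNReal.toReal_pos (eLpNorm_hat_ne_zero hs hdec wdatum_ne one_ne_zero) (hfin 1)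
  have hA₂ : 0 < A₂ :=
    ENNReal.toReal_pos (eLpNorm_hat_ne_zero hs hdec wdatum_ne two_ne_zero) (hfin 2)
  set m : ℝ := min A₁ A₂ with hm_def
  have hm : 0 < m := lt_min hA₁ hA₂
  have hmA₁ : m ≤ A₁ := min_le_left _ _
  have hmA₂ : m ≤ A₂ := min_le_right _ _
  have hcoef : 0 < 2 * C / Real.pi := by positivity
  have hν : 0 < 2 * C / Real.pi * m := mul_pos hcoef hm
  obtain ⟨α, hα, hlt⟩ := hG _ hν wdatum isDatum_wdatum
  -- the weighted norms of the rescaled datum are finite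
  have hDα := isDatum_rescale isDatum_wdatum hα
  obtain ⟨hfin1, hfin2⟩ := eLpNorm_weightFn_lt_top hDα.1 hDα.2.2
  set N₁ : ℝ := (eLpNorm (weightFn 2 (fun x => wdatum (α⁻¹ • x))) 1 volume).toReal with hN₁def
  set N₂ : ℝ := (eLpNorm (weightFn 2 (fun x => wdatum (α⁻¹ • x))) 2 volume).toReal with hN₂def
  have hN₁_nonneg : 0 ≤ N₁ := ENNReal.toReal_nonneg
  have hN₂_nonneg : 0 ≤ N₂ := ENNReal.toReal_nonneg
  -- the printed threshold, unfolded
  have hthr : threshold C (fun x => wdatum (α⁻¹ • x)) = 2 * C / Real.pi * (N₁ + N₂) := rfl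
  rw [hthr] at hlt
  have hlt' : N₁ + N₂ < α * m := by
    rw [show α * (2 * C / Real.pi * m) = 2 * C / Real.pi * (α * m) by ring] at hlt
    exact lt_of_mul_lt_mul_left hlt hcoef.le
  -- L¹ lower bound: `A₁ ≤ N₁`
  have hB₁ : A₁ ≤ N₁ := by
    have h := ENNReal.toReal_mono hfin1.ne (eLpNorm_weightFn_rescale_ge hmeas hα 1)
    have hone : ENNReal.ofReal (α ^ 3) * (ENNReal.ofReal (α ^ 3)⁻¹ ^ (1 / (1 : ℝ≥0∞)).toReal *
        eLpNorm (hat wdatum) 1 volume) = eLpNorm (hat wdatum) 1 volume := by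
      rw [div_one, ENNReal.toReal_one, ENNReal.rpow_one, ← mul_assoc,
        ← ENNReal.ofReal_mul (pow_pos hα 3).le, mul_inv_cancel₀ (pow_pos hα 3).ne',
        ENNReal.ofReal_one, one_mul]
    rwa [hone] at h
  -- L² lower bound: `α^{3/2} A₂ ≤ N₂`, with `α^{3/2}` written as `α³ √(α⁻³)`
  have hB₂ : α ^ 3 * Real.sqrt (α ^ 3)⁻¹ * A₂ ≤ N₂ := by
    have h := ENNReal.toReal_mono hfin2.ne (eLpNorm_weightFn_rescale_ge hmeas hα 2)
    have htwo : (1 / (2 : ℝ≥0∞)).toReal = 1 / 2 := by simp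
    rw [htwo, ENNReal.toReal_mul, ENNReal.toReal_mul, ← ENNReal.toReal_rpow,
      ENNReal.toReal_ofReal (pow_pos hα 3).le,
      ENNReal.toReal_ofReal (inv_pos.mpr (pow_pos hα 3)).le, ← Real.sqrt_eq_rpow, ← mul_assoc] at h
    exact h
  rcases le_total α 1 with hα1 | hα1
  · -- `α ≤ 1`: the `L¹` part already exceeds `α·m`
    have : α * m ≤ m := mul_le_of_le_one_left hm.le hα1
    linarith
  · -- `α ≥ 1`: the `L²` part exceeds `α·m`
    set B : ℝ := α ^ 3 * Real.sqrt (α ^ 3)⁻¹ with hB_def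
    have hB_nonneg : 0 ≤ B := by positivity
    have hB_sq : B ^ 2 = α ^ 3 := by
      rw [hB_def, mul_pow, Real.sq_sqrt (inv_pos.mpr (pow_pos hα 3)).le]
      field_simp
    have hBα : α ≤ B := by
      by_contra hcon
      have hcon' : B < α := lt_of_not_ge hcon
      have h1 : B * B < α * α := mul_self_lt_mul_self hB_nonneg hcon'
      have h2 : α ^ 2 ≤ α ^ 3 := pow_le_pow_right₀ hα1 (by norm_num)
      nlinarith
    have h3 : α * m ≤ B * A₂ :=
      (mul_le_mul_of_nonneg_left hmA₂ hα.le).trans (mul_le_mul_of_nonneg_right hBα hA₂.le)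
    linarith

/-- Closed instance for the refutes index: the glue fails already for `C = 1`.
[cite: VasquezCampos2024, §2 l.713 p.5; Cor. 23 proof l.2301–2306 p.27] -/
theorem not_GlueThreshold_one : ¬ Literature.Claims.NS.VasquezCampos2024.GlueThreshold 1 :=
  not_GlueThreshold one_pos

end Summit.NavierStokesRegularity.NavierStokesRegularity.Theorems.VasquezCampos2024

end
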